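import Literature.Probability.RandomPlanarGeometry.SLEBubblesAvoidance
import Literature.Probability.RandomPlanarGeometry.BubbleConfigEvents
import Literature.Probability.RandomPlanarGeometry.LoewnerInverseMeasurable
import Literature.Probability.RandomPlanarGeometry.LoewnerInverseContinuity
import Literature.Probability.RandomPlanarGeometry.SLERestrictionTwoSided
import HarnessLib

/-!
# The bubble-cloud event `{X ∩ s_ω = ∅}` of [LSW] §7.2 is an event, and `{Ξ(κ) ∩ A = ∅}` is null-measurable given [RS]

Proof companion of `Literature.Probability.RandomPlanarGeometry.SLEBubblesVersion` (its named fact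
`SLEBubbles.nullMeasurableSet_disjoint`, the measurability half of [LSW] Thm. 7.3) and of
`Literature.Probability.RandomPlanarGeometry.SLEBubblesAvoidance` /
`Literature.Probability.RandomPlanarGeometry.SLEBubblesAvoidanceProofs` (the set `s_ω`), after

* G. F. Lawler, O. Schramm, W. Werner, *Conformal restriction: the chordal case*, J. Amer. Math.
  Soc. **16** (2003) 917–955, arXiv:math/0209343 (**[LSW]**, arXiv page numbers), §7.2 (p. 28:
  "Consider a Poisson point process `X` on `Ω_b × [0, ∞)` with mean `λ μ × dt` […] We take `γ`
  to be independent from `X`. Since `κ ≤ 8/3`, we know from [RS] that `γ` is a simple curve. Let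
  `X̂ := {g_t⁻¹(K + W_t) : (K, t) ∈ X}` […] `Ξ = F^ℝ_ℍ(γ(0, ∞) ∪ ⋃ X̂)`"; p. 28, first display of
  the proof of (7.3): "`P[{K : g_t⁻¹(K + W_t) ∩ A ≠ ∅} | g_t]`"; (7.3), p. 29:
  "`P[Ξ ∩ A = ∅] = Φ_A'(0)^α`"), which leaves the measurability of these events implicit;
* S. Rohde, O. Schramm, *Basic properties of SLE*, Ann. of Math. **161** (2005), §3 p. 896
  ("`f̂ₛ` is measurable with respect to `σ(ξ(u), u ≤ s)`"; the tree's
  `measurable_loewnerInv_sleDriving`) and Thm. 5.1 (SLE_κ, `κ ≠ 8`, is generated by a curve;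
  the tree's named fact `hasSLETrace_of_ne_eight`).

With `s_ω = {(K, t) ∈ Ω_b × [0, ∞) : g_t⁻¹(K + W_t) ∩ A ≠ ∅}` (`bubbleHitSet`; measurable for
every sample, `measurableSet_bubbleHitSet` of `SLEBubblesAvoidanceProofs`) and
`{Ξ ∩ A = ∅} = {γ ∩ A = ∅} ∩ {X ∩ s_ω = ∅}` (`disjoint_sleBubbleSet_iff` of
`SLEBubblesAvoidance`), this file PROVES:

* `Literature.Probability.RandomPlanarGeometry.SLEBubbles.nullMeasurableSet_inter_bubbleHitSet_eq_empty`
  — **the event `{(ω, ω') : X(ω') ∩ s_ω = ∅}` ("no attached bubble meets `A`") is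
  null-measurable for `preWienerMeasure ⊗ P'`, UNCONDITIONALLY** (for every `κ`, every closed
  `A`, `X` a Poisson cloud with mean `λ_κ μ ⊗ dt`, `μ` a Brownian bubble measure). This is a
  JOINT measurability statement in the driving sample and the cloud, not a consequence of the
  measurability of each `s_ω`: on the full-measure set where the cloud has finitely many points
  in each window `spanningSets μ k × [0, k]` of finite mean measure
  (`ae_finite_inter_of_isPoissonCloud`; `μ` is σ-finite, `IsBrownianBubbleMeasure.sigmaFinite`),
  the event is the countable Boolean combination
  `⋂ₖ ⋂ⱼ ⋃ₘ ⋂_boxes ({ω : the box is not close to A} × Ω' ∪ Ω × {ω' : X ∩ window ∩ rectangle = ∅})`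
  over the dyadic boxes `[c/2ⁿ, (c+1)/2ⁿ] × Q` of `[0, ∞) × ℍₒ` (`Q` a closed dyadic square of a
  row `≥ 1`) and their hitting rectangles `{K : K ∩ Q ∩ {‖z‖ ≥ 1/(j+1)} ≠ ∅} × [c/2ⁿ, (c+1)/2ⁿ]`
  (measurable, `BubbleConfig.measurableSet_hit_of_isCompact` of `BubbleConfigEvents`). Writing
  `g_t⁻¹(K + W_t) = f̂ₜ(K)` with Rohde–Schramm's `f̂ₜ(z) = fₜ(W_t + z)` (`Loewner.fHat`;
  `attachedBubble_eq_image_fHat`), the two inputs are that `(t, z) ↦ f̂ₜ(z)` is jointly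
  continuous on `[0, ∞) × ℍₒ` (`Loewner.continuousAt_loewnerInv_uncurry` of
  `LoewnerInverseContinuity`) — so that "no point of the finitely many compact pieces
  `K ∩ {‖z‖ ≥ 1/(j+1)}` (`cl K = K ∪ {0}`) is mapped into `A`" is equivalent to "for some `m`, no
  box on which `f̂` is `(1/(m+1))⁻`-close to `A` carries a pair `(K, t)` in its rectangle" — and
  that `ω ↦ f̂ₜ(z)[√κ B(ω)]` is measurable (`measurable_fHat_sleDriving`, from
  `measurable_loewnerInv_sleDriving` and joint measurability in `(w, ω)`), closeness of a box
  being tested on a countable dense subset of it.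
* Consequently the named fact `SLEBubbles.nullMeasurableSet_disjoint` of `SLEBubblesVersion`
  (null-measurability of `{Ξ(κ) ∩ A = ∅}`) holds AS SOON AS the marginals of the SLE_κ trace
  are a.e.-measurable (`SLEBubbles.nullMeasurableSet_disjoint_of_aemeasurable`; `{γ ∩ A = ∅}` is
  then null-measurable by continuity of the trace, `nullMeasurableSet_disjoint_range`), in
  particular under the Rohde–Schramm theorem (`SLEBubbles.nullMeasurableSet_disjoint_of_hasSLETrace`,
  `SLEBubbles.nullMeasurableSet_disjoint_of_hasSLETrace_of_ne_eight`, via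
  `aemeasurable_sleTrace_holds`); and so does [LSW] (7.3) given [RS], the measurability of `s_ω`
  and Theorem 6.5 (`SLEBubbles.measure_disjoint_of_hasSLETrace_of_ne_eight`, by
  `SLEBubbles.measure_disjoint_of_leaves`). The tree knows the measurability of `ω ↦ γ(t)`
  only on the event that the chain is generated by a curve (off it `sleTrace` is a junk
  constant), which is why [RS] — invoked by [LSW] at this very point — is the remaining input:
  `SLEBubbles.nullMeasurableSet_disjoint_holds` is NOT claimed here.

No new definition is introduced: the boxes, rectangles and test nets are local to the proofs.
Mathlib: `measurable_uncurry_of_continuous_of_measurable`,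
`TopologicalSpace.IsSeparable.exists_countable_dense_subset`, `IsCompact.exists_isMinOn`,
`Measure.quasiMeasurePreserving_fst/snd`, `NullMeasurableSet.congr`.
-/

noncomputable section

open Set Filter Topology MeasureTheory Metric Bornology
open UpperHalfPlane (upperHalfPlaneSet isOpen_upperHalfPlaneSet)
open scoped NNReal ENNReal
open Literature.Probability.Process (preWienerMeasure IsPoissonCloud)

namespace Literature.Probability.RandomPlanarGeometry

/-! ### The attached bubbles through `f̂ₜ`; continuity and measurability of `f̂ₜ(z)` -/

/-- The attached bubble is the image of the bubble under Rohde–Schramm's `f̂ₜ = fₜ(Wₜ + ·)`.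
[folklore] -/
theorem attachedBubble_eq_image_fHat (κ : ℝ≥0) (ω : ℝ≥0 → ℝ) (K : Set ℂ) (t : ℝ≥0) :
    attachedBubble κ ω K t = Loewner.fHat (sleDriving κ ω) t '' K := by
  rw [attachedBubble, image_image]
  refine image_congr fun z _ ↦ ?_
  rw [Loewner.fHat_apply, add_comm]

/-- Membership in `s_ω` through `f̂`: `(K, t) ∈ s_ω ↔ ∃ z ∈ K, f̂ₜ(z) ∈ A`. [folklore] -/
theorem mem_bubbleHitSet_iff_exists_fHat {κ : ℝ≥0} {ω : ℝ≥0 → ℝ} {A : Set ℂ}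
    {q : BubbleConfig × ℝ≥0} :
    q ∈ bubbleHitSet κ ω A ↔ ∃ z ∈ (q.1 : Set ℂ), Loewner.fHat (sleDriving κ ω) q.2 z ∈ A := by
  rw [mem_bubbleHitSet_iff, attachedBubble_eq_image_fHat, Set.not_disjoint_iff]
  constructor
  · rintro ⟨_, ⟨z, hz, rfl⟩, hA⟩
    exact ⟨z, hz, hA⟩
  · rintro ⟨z, hz, hA⟩
    exact ⟨_, ⟨z, hz, rfl⟩, hA⟩

/-- A configuration misses `s_ω` iff no point of any of its bubbles is mapped into `A`.
[folklore] -/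
theorem inter_bubbleHitSet_eq_empty_iff {κ : ℝ≥0} {ω : ℝ≥0 → ℝ} {A : Set ℂ}
    {Xc : Set (BubbleConfig × ℝ≥0)} :
    Xc ∩ bubbleHitSet κ ω A = ∅ ↔
      ∀ q ∈ Xc, ∀ z ∈ (q.1 : Set ℂ), Loewner.fHat (sleDriving κ ω) q.2 z ∉ A := by
  simp only [eq_empty_iff_forall_notMem, mem_inter_iff, mem_bubbleHitSet_iff_exists_fHat,
    not_and, not_exists]

/-- `f̂ₜ` is continuous at every point of `ℍₒ`. [folklore] -/
theorem Loewner.continuousAt_fHat {W : ℝ≥0 → ℝ} (hW : Continuous W) (t : ℝ≥0) {z : ℂ}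
    (hz : 0 < z.im) : ContinuousAt (Loewner.fHat W t) z := by
  rw [Loewner.fHat_eq_comp]
  have him : 0 < ((W t : ℂ) + z).im := by simpa using hz
  exact (Loewner.continuousAt_loewnerInv hW t him).comp
    (continuous_const.add continuous_id).continuousAt

/-- **`(t, z) ↦ f̂ₜ(z)` is jointly continuous on `[0, ∞) × ℍₒ`** (`continuousAt_loewnerInv_uncurry`
composed with the continuous `(t, z) ↦ (t, W t + z)`). [folklore] -/
theorem Loewner.continuousAt_fHat_uncurry {W : ℝ≥0 → ℝ} (hW : Continuous W) {p : ℝ≥0 × ℂ}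
    (hp : 0 < p.2.im) : ContinuousAt (fun q : ℝ≥0 × ℂ ↦ Loewner.fHat W q.1 q.2) p := by
  have hfun : (fun q : ℝ≥0 × ℂ ↦ Loewner.fHat W q.1 q.2) =
      (fun q : ℝ≥0 × ℂ ↦ Loewner.loewnerInv W q.1 q.2) ∘ fun q ↦ (q.1, (W q.1 : ℂ) + q.2) := by
    funext q
    simp [Loewner.fHat_apply]
  rw [hfun]
  have hin : Continuous fun q : ℝ≥0 × ℂ ↦ (q.1, (W q.1 : ℂ) + q.2) :=
    continuous_fst.prodMk ((Complex.continuous_ofReal.comp (hW.comp continuous_fst)).add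
      continuous_snd)
  refine ContinuousAt.comp ?_ hin.continuousAt
  have him : 0 < ((W p.1 : ℂ) + p.2).im := by simpa using hp
  exact Loewner.continuousAt_loewnerInv_uncurry hW p.1 him

/-- `(s, w) ↦ infDist (f̂ₛ w) A` is continuous at every point of `[0, ∞) × ℍₒ`. [folklore] -/
theorem Loewner.continuousAt_infDist_fHat {W : ℝ≥0 → ℝ} (hW : Continuous W) (A : Set ℂ)
    {p : ℝ≥0 × ℂ} (hp : 0 < p.2.im) :
    ContinuousAt (fun q : ℝ≥0 × ℂ ↦ infDist (Loewner.fHat W q.1 q.2) A) p :=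
  (continuous_infDist_pt A).continuousAt.comp (Loewner.continuousAt_fHat_uncurry hW hp)

/-- **`ω ↦ f̂ₜ(z)[√κ B(ω)]` is measurable** for `z ∈ ℍₒ`: `(w, ω) ↦ fₜ^{W(ω)}(w)` is jointly
measurable on `ℍₒ × Ω` (continuous in `w`, measurable in `ω`, `measurable_loewnerInv_sleDriving`;
Mathlib `measurable_uncurry_of_continuous_of_measurable`), and is evaluated at the random point
`w = W_t(ω) + z`. [cite: RohdeSchramm2005, §3 p. 896] -/
theorem measurable_fHat_sleDriving (κ : ℝ≥0) (t : ℝ≥0) {z : ℂ} (hz : 0 < z.im) :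
    Measurable fun ω ↦ Loewner.fHat (sleDriving κ ω) t z := by
  set u : upperHalfPlaneSet → (ℝ≥0 → ℝ) → ℂ :=
    fun w ω ↦ Loewner.loewnerInv (sleDriving κ ω) t w with hu
  have hcont : ∀ ω, Continuous fun w : upperHalfPlaneSet ↦ u w ω := fun ω ↦ by
    have h : ContinuousOn (Loewner.loewnerInv (sleDriving κ ω) t) upperHalfPlaneSet :=
      continuousOn_of_forall_continuousAt fun w hw ↦
        Loewner.continuousAt_loewnerInv (continuous_sleDriving κ ω) t hw
    exact continuousOn_iff_continuous_restrict.1 h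
  have hmeas : ∀ w : upperHalfPlaneSet, Measurable (u w) := fun w ↦
    measurable_loewnerInv_sleDriving κ t w.2
  have hunc := measurable_uncurry_of_continuous_of_measurable hcont hmeas
  have hmem : ∀ ω : ℝ≥0 → ℝ, ((sleDriving κ ω t : ℂ) + z) ∈ upperHalfPlaneSet := fun ω ↦ by
    show 0 < ((sleDriving κ ω t : ℂ) + z).im
    simpa using hz
  have harg : Measurable fun ω : ℝ≥0 → ℝ ↦
      (⟨(sleDriving κ ω t : ℂ) + z, hmem ω⟩ : upperHalfPlaneSet) :=
    ((Complex.measurable_ofReal.comp (measurable_sleDriving κ t)).add_const z).subtype_mk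
  have hrepr : (fun ω ↦ Loewner.fHat (sleDriving κ ω) t z) =
      Function.uncurry u ∘ fun ω ↦ (⟨(sleDriving κ ω t : ℂ) + z, hmem ω⟩, ω) := by
    funext ω
    simp [hu, Function.uncurry, Loewner.fHat_apply]
  rw [hrepr]
  exact hunc.comp (harg.prodMk measurable_id)

/-! ### Dyadic boxes of `[0, ∞) × ℍₒ` and their hitting rectangles -/

/-- The squares of the rows `b + 1 ≥ 1` lie in `ℍₒ`. [folklore] -/
theorem im_pos_of_mem_dyadicSquare_succ {n : ℕ} {a : ℤ} {b : ℕ} {z : ℂ}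
    (hz : z ∈ dyadicSquare n a ((b : ℤ) + 1)) : 0 < z.im := by
  have h1 : (((b : ℤ) + 1 : ℤ) : ℝ) / 2 ^ n ≤ z.im := hz.2.2.1
  push_cast at h1
  have h2 : (0 : ℝ) < ((b : ℝ) + 1) / 2 ^ n := by positivity
  linarith

/-- **The hitting rectangles are measurable in `Ω_b × [0, ∞)`**: for a dyadic square `Q` of a row
`≥ 1`, a radius `r` and a measurable set of times `I`, `{K : K ∩ Q ∩ {‖z‖ ≥ r} ≠ ∅} × I` is
measurable (`Q ∩ {‖z‖ ≥ r}` is a compact subset of `ℍₒ`, `BubbleConfig.measurableSet_hit_of_isCompact`).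
[folklore] -/
theorem measurableSet_hit_dyadicSquare_prod (n : ℕ) (a : ℤ) (b : ℕ) (r : ℝ) {I : Set ℝ≥0}
    (hI : MeasurableSet I) :
    MeasurableSet (BubbleConfig.hit (dyadicSquare n a ((b : ℤ) + 1) ∩ {z | r ≤ ‖z‖}) ×ˢ I) := by
  refine MeasurableSet.prod ?_ hI
  refine BubbleConfig.measurableSet_hit_of_isCompact ?_ ?_
  · exact (Metric.isCompact_of_isClosed_isBounded isClosed_dyadicSquare
      isBounded_dyadicSquare).inter_right (isClosed_le continuous_const continuous_norm)
  · exact fun z hz ↦ im_pos_of_mem_dyadicSquare_succ hz.1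

/-- **The dyadic boxes form a neighbourhood base of `[0, ∞) × ℍₒ`**: every point `(t, z)`,
`z ∈ ℍₒ`, lies in a box `[c/2ⁿ, (c+1)/2ⁿ] × Q` (`Q` a closed dyadic square of generation `n` and
row `b + 1 ≥ 1`) all of whose points are `ε`-close to `(t, z)` in both coordinates (generation
`n` with `2/2ⁿ < min ε (Im z)`, floor indices). [folklore] -/
theorem exists_mem_dyadicBox {t : ℝ≥0} {z : ℂ} (hz : 0 < z.im) {ε : ℝ} (hε : 0 < ε) :
    ∃ (n c : ℕ) (a : ℤ) (b : ℕ),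
      (t, z) ∈ Icc ((c : ℝ≥0) / 2 ^ n) (((c : ℝ≥0) + 1) / 2 ^ n) ×ˢ dyadicSquare n a ((b : ℤ) + 1) ∧
        ∀ p ∈ Icc ((c : ℝ≥0) / 2 ^ n) (((c : ℝ≥0) + 1) / 2 ^ n) ×ˢ dyadicSquare n a ((b : ℤ) + 1),
          dist p.1 t < ε ∧ dist p.2 z < ε := by
  -- a fine generation
  obtain ⟨n, hn⟩ : ∃ n : ℕ, (2 : ℝ) / 2 ^ n < min ε z.im := by
    have hδ : 0 < min ε z.im := lt_min hε hz
    obtain ⟨n, hn⟩ := exists_nat_gt (2 / min ε z.im)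
    refine ⟨n, ?_⟩
    have h2n : (n : ℝ) < 2 ^ n := by exact_mod_cast Nat.lt_two_pow_self
    have h2 : (0 : ℝ) < 2 ^ n := by positivity
    rw [div_lt_iff₀ h2]
    rw [div_lt_iff₀ hδ] at hn
    nlinarith
  have hnε : (2 : ℝ) / 2 ^ n < ε := hn.trans_le (min_le_left _ _)
  have hnz : (2 : ℝ) / 2 ^ n < z.im := hn.trans_le (min_le_right _ _)
  have h2 : (0 : ℝ) < 2 ^ n := by positivity
  have h12 : (1 : ℝ) / 2 ^ n < ε := by
    have : (1 : ℝ) / 2 ^ n ≤ 2 / 2 ^ n := by gcongr; norm_num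
    linarith
  -- indices
  set c : ℕ := ⌊(2 : ℝ) ^ n * t⌋₊ with hc
  set a : ℤ := ⌊(2 : ℝ) ^ n * z.re⌋ with ha
  set b' : ℤ := ⌊(2 : ℝ) ^ n * z.im⌋ with hb'
  have hb'1 : 1 ≤ b' := by
    rw [hb', Int.le_floor]
    push_cast
    rw [div_lt_iff₀ h2] at hnz
    linarith
  set b : ℕ := (b' - 1).toNat with hb
  have hbb' : (b : ℤ) + 1 = b' := by
    rw [hb, Int.toNat_of_nonneg (by linarith)]
    ring
  have hct : (c : ℝ) ≤ 2 ^ n * t := Nat.floor_le (by positivity)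
  have htc : (2 : ℝ) ^ n * t < c + 1 := Nat.lt_floor_add_one _
  have ht1 : (c : ℝ) / 2 ^ n ≤ t := by rw [div_le_iff₀ h2]; linarith
  have ht2 : (t : ℝ) ≤ ((c : ℝ) + 1) / 2 ^ n := by rw [le_div_iff₀ h2]; linarith
  have hzQ : z ∈ dyadicSquare n a ((b : ℤ) + 1) := by
    rw [hbb']
    exact mem_dyadicSquare_floor z n
  refine ⟨n, c, a, b, ⟨⟨?_, ?_⟩, hzQ⟩, ?_⟩
  · rw [← NNReal.coe_le_coe]
    push_cast
    exact ht1
  · rw [← NNReal.coe_le_coe]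
    push_cast
    exact ht2
  · rintro ⟨s, w⟩ ⟨hs, hw⟩
    have hs1 : (c : ℝ) / 2 ^ n ≤ s := by
      have := hs.1
      rw [← NNReal.coe_le_coe] at this
      push_cast at this
      exact this
    have hs2 : (s : ℝ) ≤ ((c : ℝ) + 1) / 2 ^ n := by
      have := hs.2
      rw [← NNReal.coe_le_coe] at this
      push_cast at this
      exact this
    have hlen : ((c : ℝ) + 1) / 2 ^ n - (c : ℝ) / 2 ^ n = 1 / 2 ^ n := by ring
    constructor
    · show dist s t < ε
      rw [NNReal.dist_eq, abs_sub_lt_iff]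
      constructor <;> linarith
    · show dist w z < ε
      calc dist w z ≤ 2 / 2 ^ n := dist_le_of_mem_dyadicSquare hw hzQ
        _ < ε := hnε

/-- **A box through a point mapped into `A` on which `f̂` stays close to `A`**: if `z ∈ ℍₒ` and
`f̂ₜ(z) ∈ A`, then for every `m` some dyadic box through `(t, z)` has
`infDist (f̂ₛ w) A ≤ 1/(m+1) − 1/(l+1)` at all its points `(s, w)`, for some `l` (joint
continuity of `f̂` and `exists_mem_dyadicBox`; `l = 2m + 1`). [folklore] -/
theorem exists_dyadicBox_infDist_le {W : ℝ≥0 → ℝ} (hW : Continuous W) (A : Set ℂ) {t : ℝ≥0}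
    {z : ℂ} (hz : 0 < z.im) (hzA : Loewner.fHat W t z ∈ A) (m : ℕ) :
    ∃ (n c : ℕ) (a : ℤ) (b : ℕ),
      (t, z) ∈ Icc ((c : ℝ≥0) / 2 ^ n) (((c : ℝ≥0) + 1) / 2 ^ n) ×ˢ dyadicSquare n a ((b : ℤ) + 1) ∧
        ∃ l : ℕ, ∀ p ∈ Icc ((c : ℝ≥0) / 2 ^ n) (((c : ℝ≥0) + 1) / 2 ^ n) ×ˢ
          dyadicSquare n a ((b : ℤ) + 1),
            infDist (Loewner.fHat W p.1 p.2) A ≤ 1 / ((m : ℝ) + 1) - 1 / ((l : ℝ) + 1) := by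
  set f : ℝ≥0 × ℂ → ℝ := fun p ↦ infDist (Loewner.fHat W p.1 p.2) A with hf
  have hfc : ContinuousAt f (t, z) := Loewner.continuousAt_infDist_fHat hW A (p := (t, z)) hz
  have hf0 : f (t, z) = 0 := infDist_zero_of_mem hzA
  have hθ : (0 : ℝ) < 1 / (2 * ((m : ℝ) + 1)) := by positivity
  obtain ⟨ε, hε, hball⟩ := Metric.continuousAt_iff.1 hfc _ hθ
  obtain ⟨n, c, a, b, hmem, hsmall⟩ := exists_mem_dyadicBox (t := t) hz hε
  refine ⟨n, c, a, b, hmem, 2 * m + 1, fun p hp ↦ ?_⟩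
  have hdist : dist p (t, z) < ε := by
    obtain ⟨hd1, hd2⟩ := hsmall p hp
    rw [Prod.dist_eq]
    exact max_lt hd1 hd2
  have hfp := hball hdist
  rw [hf0, Real.dist_eq, sub_zero, abs_of_nonneg infDist_nonneg] at hfp
  have harith : (1 : ℝ) / ((m : ℝ) + 1) - 1 / (((2 * m + 1 : ℕ) : ℝ) + 1) =
      1 / (2 * ((m : ℝ) + 1)) := by
    push_cast
    field_simp
    ring
  rw [harith]
  exact hfp.le

/-! ### Level conditions of `f̂` on a set of `[0, ∞) × ℍₒ` are decided on a dense subset -/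

/-- **A closed level condition on `f̂` over a closed set `B ⊆ [0, ∞) × ℍₒ` is decided on a dense
subset `D ⊆ B`**: if `infDist (f̂ₛ(w)) A ≤ θ` on `D` then on `B` (`(s, w) ↦ f̂ₛ(w)` is continuous
on `B`). [folklore] -/
theorem forall_infDist_fHat_le_of_dense {W : ℝ≥0 → ℝ} (hW : Continuous W) (A : Set ℂ)
    {B D : Set (ℝ≥0 × ℂ)} (hB : ∀ p ∈ B, 0 < p.2.im) (hBc : IsClosed B) (hDB : D ⊆ B)
    (hBD : B ⊆ closure D) {θ : ℝ} (h : ∀ d ∈ D, infDist (Loewner.fHat W d.1 d.2) A ≤ θ) :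
    ∀ p ∈ B, infDist (Loewner.fHat W p.1 p.2) A ≤ θ := by
  set f : ℝ≥0 × ℂ → ℝ := fun p ↦ infDist (Loewner.fHat W p.1 p.2) A with hf
  have hfc : ContinuousOn f B := continuousOn_of_forall_continuousAt fun p hp ↦
    Loewner.continuousAt_infDist_fHat hW A (hB p hp)
  intro p hp
  have hcl : closure D ⊆ B := hBc.closure_subset_iff.2 hDB
  have h1 : f p ∈ closure (f '' D) := (hfc.mono hcl).image_closure ⟨p, hBD hp, rfl⟩
  have h2 : closure (f '' D) ⊆ Iic θ :=
    isClosed_Iic.closure_subset_iff.2 (by rintro _ ⟨d, hd, rfl⟩; exact h d hd)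
  exact h2 h1

/-- **The level events of `f̂` over a countable set of points of `ℍₒ` are measurable in the
Brownian sample**: `{ω : infDist (f̂ₛ(w)[√κ B(ω)]) A ≤ θ for all (s, w) ∈ D}` is a countable
intersection of measurable sets (`measurable_fHat_sleDriving`). [folklore] -/
theorem measurableSet_forall_infDist_fHat_le (κ : ℝ≥0) (A : Set ℂ) {D : Set (ℝ≥0 × ℂ)}
    (hDc : D.Countable) (hD : ∀ d ∈ D, 0 < d.2.im) (θ : ℝ) :
    MeasurableSet {ω : ℝ≥0 → ℝ | ∀ d ∈ D, infDist (Loewner.fHat (sleDriving κ ω) d.1 d.2) A ≤ θ} := by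
  have : {ω : ℝ≥0 → ℝ | ∀ d ∈ D, infDist (Loewner.fHat (sleDriving κ ω) d.1 d.2) A ≤ θ} =
      ⋂ d ∈ D, {ω : ℝ≥0 → ℝ | infDist (Loewner.fHat (sleDriving κ ω) d.1 d.2) A ≤ θ} := by
    ext ω
    simp only [mem_setOf_eq, mem_iInter]
  rw [this]
  refine MeasurableSet.biInter hDc fun d hd ↦ ?_
  exact measurableSet_le ((continuous_infDist_pt A).measurable.comp
    (measurable_fHat_sleDriving κ d.1 (hD d hd))) measurable_const

/-! ### A positive margin off `A` on the compact pieces `K ∩ {‖z‖ ≥ r}` of a bubble -/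

/-- The part of a bubble outside the open disc `B(0, r)`, `r > 0`, is compact (`cl K = K ∪ {0}`
and `K` is bounded). [folklore] -/
theorem BubbleConfig.isCompact_inter_le_norm (K : BubbleConfig) {r : ℝ} (hr : 0 < r) :
    IsCompact ((K : Set ℂ) ∩ {z | r ≤ ‖z‖}) := by
  have hcl : IsClosed ((K : Set ℂ) ∩ {z | r ≤ ‖z‖}) := by
    have hKr : (K : Set ℂ) ∩ {z | r ≤ ‖z‖} = closure (K : Set ℂ) ∩ {z | r ≤ ‖z‖} := by
      rw [K.closure_eq]
      ext z
      simp only [mem_inter_iff, mem_union, mem_singleton_iff, mem_setOf_eq]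
      constructor
      · rintro ⟨hz, hzr⟩
        exact ⟨Or.inl hz, hzr⟩
      · rintro ⟨hz | hz, hzr⟩
        · exact ⟨hz, hzr⟩
        · exfalso
          rw [hz, norm_zero] at hzr
          linarith
    rw [hKr]
    exact isClosed_closure.inter (isClosed_le continuous_const continuous_norm)
  exact Metric.isCompact_of_isClosed_isBounded hcl (K.isBounded.subset inter_subset_left)

/-- **A positive margin for a bubble kept off `A` by `f̂ₜ`**: if no point `z ∈ K` with `‖z‖ ≥ r`
(`r > 0`) is mapped into the nonempty closed set `A`, then `infDist (f̂ₜ z) A > 1/(m+1)` for all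
such `z`, for some `m` (a continuous positive function on the compact `K ∩ {‖z‖ ≥ r}` has a
positive minimum). [folklore] -/
theorem exists_one_div_lt_infDist_fHat {W : ℝ≥0 → ℝ} (hW : Continuous W) {A : Set ℂ}
    (hAc : IsClosed A) (hAne : A.Nonempty) (K : BubbleConfig) (t : ℝ≥0) {r : ℝ} (hr : 0 < r)
    (h : ∀ z ∈ (K : Set ℂ), r ≤ ‖z‖ → Loewner.fHat W t z ∉ A) :
    ∃ m : ℕ, ∀ z ∈ (K : Set ℂ), r ≤ ‖z‖ → 1 / ((m : ℝ) + 1) < infDist (Loewner.fHat W t z) A := by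
  set Kr : Set ℂ := (K : Set ℂ) ∩ {z | r ≤ ‖z‖} with hKr
  have hKrc : IsCompact Kr := K.isCompact_inter_le_norm hr
  set g : ℂ → ℝ := fun z ↦ infDist (Loewner.fHat W t z) A with hg
  have hgc : ContinuousOn g Kr := continuousOn_of_forall_continuousAt fun z hz ↦
    (continuous_infDist_pt A).continuousAt.comp
      (Loewner.continuousAt_fHat hW t (K.subset_upperHalfPlaneSet hz.1))
  rcases Kr.eq_empty_or_nonempty with hemp | hne
  · refine ⟨0, fun z hz hzr ↦ ?_⟩
    have : z ∈ Kr := ⟨hz, hzr⟩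
    rw [hemp] at this
    exact absurd this (notMem_empty _)
  · obtain ⟨z₀, hz₀, hmin⟩ := hKrc.exists_isMinOn hne hgc
    have hpos : 0 < g z₀ := (hAc.notMem_iff_infDist_pos hAne).1 (h z₀ hz₀.1 hz₀.2)
    obtain ⟨m, hm⟩ := exists_nat_one_div_lt hpos
    exact ⟨m, fun z hz hzr ↦ hm.trans_le (hmin ⟨hz, hzr⟩)⟩

/-! ### Finiteness of the cloud in windows of finite mean measure -/

/-- **A Poisson cloud has almost surely finitely many points in a set of finite mean measure**
(`N(s) ~ Poisson(Λ s)` takes values in `ℕ`). [cite: Kingman1993, §2.1] -/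
theorem ae_finite_inter_of_isPoissonCloud {E Ω : Type*} [MeasurableSpace E] [MeasurableSpace Ω]
    {Λ : Measure E} {X : Ω → Set E} {P : Measure Ω} (h : IsPoissonCloud Λ X P) {s : Set E}
    (hs : MeasurableSet s) (hΛ : Λ s ≠ ∞) : ∀ᵐ ω ∂P, (X ω ∩ s).Finite := by
  rw [ae_iff]
  have hset : {ω | ¬(X ω ∩ s).Finite} = (fun ω ↦ (X ω ∩ s).encard) ⁻¹' {⊤} := by
    ext ω
    simp only [mem_setOf_eq, mem_preimage, mem_singleton_iff, encard_eq_top_iff, Set.Infinite]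
  rw [hset, ← Measure.map_apply (h.measurable_encard hs) (measurableSet_singleton _),
    h.map_encard hs hΛ, Measure.map_apply measurable_from_top (measurableSet_singleton _)]
  have : ((↑) : ℕ → ℕ∞) ⁻¹' {⊤} = ∅ := by
    ext n
    simp
  rw [this, measure_empty]

/-- `dt[0, k] < ∞`. [folklore] -/
theorem timeMeasure_Iic_lt_top (k : ℝ≥0) : timeMeasure (Iic k) < ∞ := by
  rw [timeMeasure, Measure.map_apply measurable_real_toNNReal measurableSet_Iic,
    Measure.restrict_apply (measurable_real_toNNReal measurableSet_Iic)]
  refine (measure_mono (?_ : Real.toNNReal ⁻¹' Iic k ∩ Ici 0 ⊆ Icc 0 k)).trans_lt ?_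
  · rintro x ⟨hx, hx0⟩
    refine ⟨hx0, ?_⟩
    have : x.toNNReal ≤ k := hx
    rwa [Real.toNNReal_le_iff_le_coe] at this
  · rw [Real.volume_Icc]
    exact ENNReal.ofReal_lt_top

/-- The windows `spanningSets μ k × [0, k]` of `Ω_b × [0, ∞)` have finite mean measure
`λ_κ μ(spanningSets μ k) · k`. [folklore] -/
theorem bubbleCloudIntensity_window_lt_top (κ : ℝ≥0) (μ : Measure BubbleConfig) [SigmaFinite μ]
    (k : ℕ) : bubbleCloudIntensity κ μ (spanningSets μ k ×ˢ Iic (k : ℝ≥0)) < ∞ := by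
  rw [bubbleCloudIntensity, Measure.smul_apply, smul_eq_mul, Measure.prod_prod]
  refine ENNReal.mul_lt_top ?_ (ENNReal.mul_lt_top (measure_spanningSets_lt_top μ k)
    (timeMeasure_Iic_lt_top k))
  rw [sleBubbleIntensity]
  exact ENNReal.ofReal_lt_top

/-! ### The bubble half of `{Ξ(κ) ∩ A = ∅}`: `{X ∩ s_ω = ∅}` is a null-measurable event -/

section Cloud

variable {κ : ℝ≥0} {μ : Measure BubbleConfig} {Ω' : Type} [MeasurableSpace Ω'] {P' : Measure Ω'}
  {X : Ω' → Set (BubbleConfig × ℝ≥0)} {A : Set ℂ}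

/-- **The event `{(ω, ω') : X(ω') ∩ s_ω = ∅}` — no attached bubble `g_t⁻¹(K + W_t)`, `(K, t) ∈ X`,
meets the closed set `A` — is null-measurable for `preWienerMeasure ⊗ P'`** (UNCONDITIONALLY;
`X` a Poisson cloud with mean `λ_κ μ ⊗ dt`, `μ` a Brownian bubble measure, hence σ-finite). On
the full-measure set where the cloud has finitely many points in each window
`spanningSets μ k × [0, k]` (`ae_finite_inter_of_isPoissonCloud`) the event is
`⋂ₖ ⋂ⱼ ⋃ₘ ⋂_boxes ({ω : the box is not (1/(m+1))⁻-close to A} × Ω' ∪ Ω × {ω' : no point of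
X ∩ window k in the hitting rectangle of the box at radius 1/(j+1)})`: for a FINITE set of
pairs `(K, t)`, "no point `z ∈ K`, `‖z‖ ≥ 1/(j+1)`, is mapped into `A`" iff "for some `m`, no
close box carries a pair in its rectangle" (the finitely many margins of
`exists_one_div_lt_infDist_fHat` have a common `m`; conversely `exists_dyadicBox_infDist_le`).
Closeness is tested on countable dense subsets of the boxes (`forall_infDist_fHat_le_of_dense`),
so these are countable combinations of measurable rectangles
(`measurableSet_forall_infDist_fHat_le`, `IsPoissonCloud.measurableSet_inter_eq_empty`,
`measurableSet_hit_dyadicSquare_prod`).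
[cite: LawlerSchrammWerner2003Restriction, §7.2 (pp. 28–29, proof of (7.3))] -/
theorem SLEBubbles.nullMeasurableSet_inter_bubbleHitSet_eq_empty (hμ : IsBrownianBubbleMeasure μ)
    (hX : IsPoissonCloud (bubbleCloudIntensity κ μ) X P') (hAc : IsClosed A) :
    NullMeasurableSet {p : (ℝ≥0 → ℝ) × Ω' | X p.2 ∩ bubbleHitSet κ p.1 A = ∅}
      (preWienerMeasure.prod P') := by
  classical
  have hset : {p : (ℝ≥0 → ℝ) × Ω' | X p.2 ∩ bubbleHitSet κ p.1 A = ∅} =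
      {p | ∀ q ∈ X p.2, ∀ z ∈ (q.1 : Set ℂ), Loewner.fHat (sleDriving κ p.1) q.2 z ∉ A} := by
    ext p
    exact inter_bubbleHitSet_eq_empty_iff
  rw [hset]
  rcases A.eq_empty_or_nonempty with rfl | hAne
  · have : {p : (ℝ≥0 → ℝ) × Ω' | ∀ q ∈ X p.2, ∀ z ∈ (q.1 : Set ℂ),
        Loewner.fHat (sleDriving κ p.1) q.2 z ∉ (∅ : Set ℂ)} = univ :=
      eq_univ_of_forall fun p q _ z _ ↦ notMem_empty _
    rw [this]
    exact nullMeasurableSet_univ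
  haveI : SigmaFinite μ := hμ.sigmaFinite
  -- the boxes, their countable dense nets, and their hitting rectangles at radius `r`
  set box : ℕ × ℕ × ℤ × ℕ → Set (ℝ≥0 × ℂ) := fun i ↦
    Icc ((i.2.1 : ℝ≥0) / 2 ^ i.1) (((i.2.1 : ℝ≥0) + 1) / 2 ^ i.1) ×ˢ
      dyadicSquare i.1 i.2.2.1 ((i.2.2.2 : ℤ) + 1) with hbox
  have hboxH : ∀ i, ∀ p ∈ box i, 0 < p.2.im := fun i p hp ↦ im_pos_of_mem_dyadicSquare_succ hp.2
  have hboxc : ∀ i, IsClosed (box i) := fun i ↦ isClosed_Icc.prod isClosed_dyadicSquare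
  have hnet : ∀ i : ℕ × ℕ × ℤ × ℕ, ∃ D ⊆ box i, D.Countable ∧ box i ⊆ closure D := fun i ↦
    (TopologicalSpace.IsSeparable.of_separableSpace _).exists_countable_dense_subset
  choose D hDsub hDc hDcl using hnet
  set R : ℝ → (ℕ × ℕ × ℤ × ℕ) → Set (BubbleConfig × ℝ≥0) := fun r i ↦
    BubbleConfig.hit (dyadicSquare i.1 i.2.2.1 ((i.2.2.2 : ℤ) + 1) ∩ {z | r ≤ ‖z‖}) ×ˢ
      Icc ((i.2.1 : ℝ≥0) / 2 ^ i.1) (((i.2.1 : ℝ≥0) + 1) / 2 ^ i.1) with hR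
  have hRm : ∀ r i, MeasurableSet (R r i) := fun r i ↦
    measurableSet_hit_dyadicSquare_prod _ _ _ _ measurableSet_Icc
  -- the key equivalence, for a FINITE set of pairs and a driving sample
  have key : ∀ (ω : ℝ≥0 → ℝ) {Y : Set (BubbleConfig × ℝ≥0)}, Y.Finite → ∀ {r : ℝ}, 0 < r →
      ((∀ q ∈ Y, ∀ z ∈ (q.1 : Set ℂ), r ≤ ‖z‖ → Loewner.fHat (sleDriving κ ω) q.2 z ∉ A) ↔
        ∃ m : ℕ, ∀ i : ℕ × ℕ × ℤ × ℕ,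
          (∃ l : ℕ, ∀ p ∈ box i, infDist (Loewner.fHat (sleDriving κ ω) p.1 p.2) A ≤
            1 / ((m : ℝ) + 1) - 1 / ((l : ℝ) + 1)) → Y ∩ R r i = ∅) := by
    intro ω Y hY r hr
    have hW := continuous_sleDriving κ ω
    constructor
    · intro h
      -- a uniform positive margin `1/(m+1)` over the finitely many bubbles of `Y`
      have hq : ∀ q : BubbleConfig × ℝ≥0, ∃ m : ℕ, q ∈ Y → ∀ z ∈ (q.1 : Set ℂ), r ≤ ‖z‖ →
          1 / ((m : ℝ) + 1) < infDist (Loewner.fHat (sleDriving κ ω) q.2 z) A := fun q ↦ by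
        by_cases hqY : q ∈ Y
        · obtain ⟨m, hm⟩ := exists_one_div_lt_infDist_fHat hW hAc hAne q.1 q.2 hr (h q hqY)
          exact ⟨m, fun _ ↦ hm⟩
        · exact ⟨0, fun h' ↦ absurd h' hqY⟩
      choose mq hmq using hq
      refine ⟨hY.toFinset.sup mq, fun i hi ↦ ?_⟩
      obtain ⟨l, hl⟩ := hi
      refine eq_empty_of_forall_notMem fun q hq' ↦ ?_
      obtain ⟨hqY, hqhit, hqt⟩ := hq'
      -- a point of the bubble in the square, of norm `≥ r`
      rw [BubbleConfig.mem_hit, Set.not_disjoint_iff] at hqhit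
      obtain ⟨z, hzK, hzQ, hzr⟩ := hqhit
      have h1 := hmq q hqY z hzK hzr
      have h2 := hl (q.2, z) ⟨hqt, hzQ⟩
      have h3 : (1 : ℝ) / (((hY.toFinset.sup mq : ℕ) : ℝ) + 1) ≤ 1 / ((mq q : ℝ) + 1) := by
        have : mq q ≤ hY.toFinset.sup mq := Finset.le_sup (hY.mem_toFinset.2 hqY)
        have : (mq q : ℝ) ≤ ((hY.toFinset.sup mq : ℕ) : ℝ) := by exact_mod_cast this
        gcongr
      have h4 : (0 : ℝ) < 1 / ((l : ℝ) + 1) := by positivity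
      simp only at h2
      linarith
    · rintro ⟨m, hm⟩ q hqY z hzK hzr hzA
      have hzim : 0 < z.im := q.1.subset_upperHalfPlaneSet hzK
      obtain ⟨n, c, a, b, hmem, hl⟩ := exists_dyadicBox_infDist_le hW A hzim hzA m
      have hempty := hm (n, c, a, b) hl
      have hqmem : q ∈ Y ∩ R r (n, c, a, b) := by
        refine ⟨hqY, ?_, hmem.1⟩
        rw [BubbleConfig.mem_hit, Set.not_disjoint_iff]
        exact ⟨z, hzK, hmem.2, hzr⟩
      rw [hempty] at hqmem
      exact hqmem
  -- windows of finite mean measure, and the a.s. finiteness of the cloud in them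
  set E : ℕ → Set (BubbleConfig × ℝ≥0) := fun k ↦ spanningSets μ k ×ˢ Iic (k : ℝ≥0) with hE
  have hEm : ∀ k, MeasurableSet (E k) := fun k ↦
    (measurableSet_spanningSets μ k).prod measurableSet_Iic
  have hEfin : ∀ k, bubbleCloudIntensity κ μ (E k) ≠ ∞ := fun k ↦
    (bubbleCloudIntensity_window_lt_top κ μ k).ne
  have hEcover : ∀ q : BubbleConfig × ℝ≥0, ∃ k, q ∈ E k := fun q ↦ by
    obtain ⟨k₁, hk₁⟩ : ∃ k, q.1 ∈ spanningSets μ k := by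
      have hq : q.1 ∈ ⋃ k, spanningSets μ k := by
        rw [iUnion_spanningSets]
        exact mem_univ _
      exact mem_iUnion.1 hq
    obtain ⟨k₂, hk₂⟩ := exists_nat_ge q.2
    refine ⟨max k₁ k₂, monotone_spanningSets μ (le_max_left _ _) hk₁, ?_⟩
    show q.2 ≤ ((max k₁ k₂ : ℕ) : ℝ≥0)
    exact hk₂.trans (by exact_mod_cast le_max_right k₁ k₂)
  set G' : Set Ω' := {ω' | ∀ k, (X ω' ∩ E k).Finite} with hG'
  have hG'ae : ∀ᵐ ω' ∂P', ω' ∈ G' := by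
    have : ∀ᵐ ω' ∂P', ∀ k, (X ω' ∩ E k).Finite :=
      ae_all_iff.2 fun k ↦ ae_finite_inter_of_isPoissonCloud hX (hEm k) (hEfin k)
    exact this
  -- the measurable events on the two factors
  set Bad : (ℕ × ℕ × ℤ × ℕ) → ℕ → Set (ℝ≥0 → ℝ) := fun i m ↦
    {ω | ∃ l : ℕ, ∀ d ∈ D i, infDist (Loewner.fHat (sleDriving κ ω) d.1 d.2) A ≤
      1 / ((m : ℝ) + 1) - 1 / ((l : ℝ) + 1)} with hBad
  have hBadm : ∀ i m, MeasurableSet (Bad i m) := fun i m ↦ by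
    have : Bad i m = ⋃ l : ℕ, {ω | ∀ d ∈ D i,
        infDist (Loewner.fHat (sleDriving κ ω) d.1 d.2) A ≤ 1 / ((m : ℝ) + 1) - 1 / ((l : ℝ) + 1)} := by
      ext ω
      simp only [hBad, mem_setOf_eq, mem_iUnion]
    rw [this]
    exact MeasurableSet.iUnion fun l ↦ measurableSet_forall_infDist_fHat_le κ A (hDc i)
      (fun d hd ↦ hboxH i d (hDsub i hd)) _
  -- closeness of a box, on the box or on its net
  have hBad_iff : ∀ (ω : ℝ≥0 → ℝ) i m, ω ∈ Bad i m ↔ ∃ l : ℕ, ∀ p ∈ box i,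
      infDist (Loewner.fHat (sleDriving κ ω) p.1 p.2) A ≤ 1 / ((m : ℝ) + 1) - 1 / ((l : ℝ) + 1) :=
    fun ω i m ↦ exists_congr fun l ↦
      ⟨fun h ↦ forall_infDist_fHat_le_of_dense (continuous_sleDriving κ ω) A (hboxH i) (hboxc i)
        (hDsub i) (hDcl i) h, fun h d hd ↦ h d (hDsub i hd)⟩
  set N : ℕ → ℕ → (ℕ × ℕ × ℤ × ℕ) → Set Ω' := fun k j i ↦
    {ω' | X ω' ∩ (E k ∩ R (1 / ((j : ℝ) + 1)) i) = ∅} with hN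
  have hNm : ∀ k j i, MeasurableSet (N k j i) := fun k j i ↦
    hX.measurableSet_inter_eq_empty ((hEm k).inter (hRm _ i))
  set M : Set ((ℝ≥0 → ℝ) × Ω') := ⋂ k : ℕ, ⋂ j : ℕ, ⋃ m : ℕ, ⋂ i : ℕ × ℕ × ℤ × ℕ,
    ((Bad i m)ᶜ ×ˢ univ ∪ univ ×ˢ N k j i) with hM
  have hMm : MeasurableSet M :=
    MeasurableSet.iInter fun k ↦ MeasurableSet.iInter fun j ↦ MeasurableSet.iUnion fun m ↦
      MeasurableSet.iInter fun i ↦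
        ((hBadm i m).compl.prod MeasurableSet.univ).union (MeasurableSet.univ.prod (hNm k j i))
  -- identification on the full-measure set `univ × G'`
  have hiff : ∀ p : (ℝ≥0 → ℝ) × Ω', p.2 ∈ G' →
      ((∀ q ∈ X p.2, ∀ z ∈ (q.1 : Set ℂ), Loewner.fHat (sleDriving κ p.1) q.2 z ∉ A) ↔ p ∈ M) := by
    rintro ⟨ω, ω'⟩ hω'
    simp only [hM, mem_iInter, mem_iUnion, mem_union, mem_prod, mem_univ, and_true, true_and,
      mem_compl_iff]
    constructor
    · intro h k j
      have hrpos : (0 : ℝ) < 1 / ((j : ℝ) + 1) := by positivity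
      have h' : ∀ q ∈ X ω' ∩ E k, ∀ z ∈ (q.1 : Set ℂ), 1 / ((j : ℝ) + 1) ≤ ‖z‖ →
          Loewner.fHat (sleDriving κ ω) q.2 z ∉ A := fun q hq z hz _ ↦ h q hq.1 z hz
      obtain ⟨m, hm⟩ := (key ω (hω' k) hrpos).1 h'
      refine ⟨m, fun i ↦ ?_⟩
      by_cases hb : ω ∈ Bad i m
      · right
        show X ω' ∩ (E k ∩ R (1 / ((j : ℝ) + 1)) i) = ∅
        rw [← inter_assoc]
        exact hm i ((hBad_iff ω i m).1 hb)
      · exact Or.inl hb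
    · intro h q hq z hz
      obtain ⟨k, hk⟩ := hEcover q
      have hzpos : 0 < ‖z‖ := by
        refine norm_pos_iff.2 fun hz0 ↦ ?_
        have him : 0 < z.im := q.1.subset_upperHalfPlaneSet hz
        rw [hz0, Complex.zero_im] at him
        exact lt_irrefl _ him
      obtain ⟨j, hj⟩ := exists_nat_one_div_lt hzpos
      obtain ⟨m, hm⟩ := h k j
      have hrpos : (0 : ℝ) < 1 / ((j : ℝ) + 1) := by positivity
      have hm' : ∀ i : ℕ × ℕ × ℤ × ℕ, (∃ l : ℕ, ∀ p ∈ box i,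
          infDist (Loewner.fHat (sleDriving κ ω) p.1 p.2) A ≤ 1 / ((m : ℝ) + 1) - 1 / ((l : ℝ) + 1)) →
          (X ω' ∩ E k) ∩ R (1 / ((j : ℝ) + 1)) i = ∅ := by
        intro i hi
        rcases hm i with hb | hN'
        · exact absurd ((hBad_iff ω i m).2 hi) hb
        · rw [inter_assoc]
          exact hN'
      exact (key ω (hω' k) hrpos).2 ⟨m, hm'⟩ q ⟨hq, hk⟩ z hz hj.le
  -- conclusion: the event agrees with the measurable `M` off a null set
  refine hMm.nullMeasurableSet.congr ?_
  have hae : ∀ᵐ p ∂(preWienerMeasure.prod P'), p.2 ∈ G' :=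
    (Measure.quasiMeasurePreserving_snd (μ := preWienerMeasure) (ν := P')).ae hG'ae
  filter_upwards [hae] with p hp
  exact propext (hiff p hp).symm

/-- **Measurability half of [LSW] Thm. 7.3, given measurable trace marginals.** If the
marginals `ω ↦ γ(t)` of the SLE_κ trace are a.e.-measurable (`aemeasurable_sleTrace`, which the
tree proves under `HasSLETrace κ`), then for a Brownian bubble measure `μ`, an independent
Poisson cloud `X` with mean `λ_κ μ ⊗ dt` and `A ∈ 𝒬*`, the set `{Ξ(κ) ∩ A = ∅}` is
null-measurable for `preWienerMeasure ⊗ P'`: it is `{γ[0,∞) ∩ A = ∅} ∩ {X ∩ s_ω = ∅}`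
(`disjoint_sleBubbleSet_iff`), the first null-measurable by continuity of the trace
(`nullMeasurableSet_disjoint_range`), the second by
`SLEBubbles.nullMeasurableSet_inter_bubbleHitSet_eq_empty`.
[cite: LawlerSchrammWerner2003Restriction, Thm. 7.3 with eq. (7.3) (p. 29)] -/
theorem SLEBubbles.nullMeasurableSet_disjoint_of_aemeasurable
    (hmeas : ∀ t : ℝ≥0, AEMeasurable (fun ω ↦ sleTrace κ ω t) preWienerMeasure)
    (hμ : IsBrownianBubbleMeasure μ) (hX : IsPoissonCloud (bubbleCloudIntensity κ μ) X P')
    (hA : IsStarHull A) :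
    NullMeasurableSet {p : (ℝ≥0 → ℝ) × Ω' | Disjoint (sleBubbleSet κ p.1 (X p.2)) A}
      (preWienerMeasure.prod P') := by
  have hset : {p : (ℝ≥0 → ℝ) × Ω' | Disjoint (sleBubbleSet κ p.1 (X p.2)) A} =
      Prod.fst ⁻¹' {ω | Disjoint (range (sleTrace κ ω)) A} ∩
        {p | X p.2 ∩ bubbleHitSet κ p.1 A = ∅} := by
    ext p
    exact disjoint_sleBubbleSet_iff κ p.1 hA (X p.2)
  rw [hset]
  refine NullMeasurableSet.inter ?_
    (SLEBubbles.nullMeasurableSet_inter_bubbleHitSet_eq_empty hμ hX hA.isBoundedHull.isClosed)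
  exact (nullMeasurableSet_disjoint_range (fun ω ↦ continuous_sleTrace κ ω) hmeas
    hA.isBoundedHull.isClosed).preimage Measure.quasiMeasurePreserving_fst

end Cloud

/-! ### The named fact from the Rohde–Schramm theorem -/

/-- **`SLEBubbles.nullMeasurableSet_disjoint` holds as soon as SLE_κ, `0 < κ ≤ 8/3`, is generated
by a curve** (the marginals of the trace are then a.e.-measurable, `aemeasurable_sleTrace_holds`).
[cite: LawlerSchrammWerner2003Restriction, Thm. 7.3 with eq. (7.3) (p. 29)] -/
theorem SLEBubbles.nullMeasurableSet_disjoint_of_hasSLETrace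
    (hRS : ∀ κ : ℝ≥0, 0 < κ → κ ≤ 8 / 3 → HasSLETrace κ) : SLEBubbles.nullMeasurableSet_disjoint :=
  fun {κ} hκ0 hκ {_} hμ {_} _ {_} {_} hX {_} hA ↦
    SLEBubbles.nullMeasurableSet_disjoint_of_aemeasurable
      (fun t ↦ aemeasurable_sleTrace_holds (hRS κ hκ0 hκ) t) hμ hX hA

/-- **`SLEBubbles.nullMeasurableSet_disjoint` from the Rohde–Schramm theorem** ([RS] Thm. 5.1,
the tree's named fact `hasSLETrace_of_ne_eight`: SLE_κ, `κ ≠ 8`, is generated by a curve), which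
[LSW] §7.2 invoke at this point ("Since `κ ≤ 8/3`, we know from [RS] that `γ` is a simple
curve", p. 28). [cite: LawlerSchrammWerner2003Restriction, Thm. 7.3 with eq. (7.3) (p. 29)] -/
theorem SLEBubbles.nullMeasurableSet_disjoint_of_hasSLETrace_of_ne_eight
    (h : hasSLETrace_of_ne_eight) : SLEBubbles.nullMeasurableSet_disjoint :=
  SLEBubbles.nullMeasurableSet_disjoint_of_hasSLETrace fun κ _ hκ ↦ h (by
    intro h8
    rw [h8] at hκ
    have : ((8 : ℝ≥0) : ℝ) ≤ ((8 / 3 : ℝ≥0) : ℝ) := by exact_mod_cast hκ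
    norm_num at this)

/-- **[LSW] (7.3) from the Rohde–Schramm theorem, the measurability of `s_ω` and Theorem 6.5**:
the avoidance formula `SLEBubbles.measure_disjoint` (`P[Ξ(κ) ∩ A = ∅] = Φ'_A(0)^{α_κ}`) follows
from [RS] Thm. 5.1 (`hasSLETrace_of_ne_eight`, giving the null-measurability of `{Ξ ∩ A = ∅}`),
the fact `SLEBubbles.ae_measurableSet_bubbleHitSet` (a theorem of the tree,
`SLEBubbles.ae_measurableSet_bubbleHitSet_holds` of `SLEBubblesAvoidanceProofs`) and the Thm. 6.5
fact `SLEBubbles.lintegral_poissonAvoidance_eq_rpow` (`SLEBubbles.measure_disjoint_of_leaves`).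
[cite: LawlerSchrammWerner2003Restriction, Thm. 7.3 with eq. (7.3) (pp. 28–29)] -/
theorem SLEBubbles.measure_disjoint_of_hasSLETrace_of_ne_eight (h : hasSLETrace_of_ne_eight)
    (hfib : SLEBubbles.ae_measurableSet_bubbleHitSet)
    (h65 : SLEBubbles.lintegral_poissonAvoidance_eq_rpow) : SLEBubbles.measure_disjoint :=
  SLEBubbles.measure_disjoint_of_leaves
    (SLEBubbles.nullMeasurableSet_disjoint_of_hasSLETrace_of_ne_eight h) hfib h65

end Literature.Probability.RandomPlanarGeometry

end
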